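import Mathlib.Combinatorics.Additive.Energy
import Mathlib.Algebra.Field.Basic
import Mathlib.Algebra.Order.BigOperators.Group.Finset
import Mathlib.Tactic
import HarnessLib

/-!
# Index-level multiplicative energy versus the energy of the image set

Topic `Literature/Combinatorics/Additive`. Fully proved, elementary (folklore bookkeeping between
"multiset" energies of a map and `Finset.mulEnergy` of its image, cf. Tao–Vu §2.3): for a map
`x : ι → 𝔽` into a field whose fibres on `U` have at most two points,

  `#{q ∈ U⁴ : x q₁₁ · x q₂₂ = x q₁₂ · x q₂₁} ≤ 16 · E×((x(U)) ∖ {0}) + 16 |U|²`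

(`index_energy_le`): non-degenerate quadruples map at most 16-to-1 into the energy quadruples of
the zero-free image, and a vanishing factor on one side forces one on the other side, leaving
`4 · (2·2) · |U|²` degenerate quadruples.

Consumer: the spread-set energy bound of the DLOG band (crux `DlogGraphFlat`, `Summits/QuantumAdvantage`).
-/

namespace Literature.Combinatorics.Additive

open Finset
open scoped Combinatorics.Additive

variable {ι F : Type*} [DecidableEq ι] [Field F] [DecidableEq F]

omit [DecidableEq ι] in
/-- Degenerate quadruples with two prescribed vanishing coordinates: at most `|Z|²|U|²`. [folklore] -/
theorem card_filter_two_zero_le (U : Finset ι) (x : ι → F) (Z : Finset ι)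
    (hZ : ∀ u ∈ U, x u = 0 → u ∈ Z) (π₁ π₂ : (ι × ι) × ι × ι → ι)
    (S : Finset ((ι × ι) × ι × ι)) (hS : S.card = Z.card * Z.card * (U.card * U.card))
    (hmem : ∀ q ∈ (U ×ˢ U) ×ˢ (U ×ˢ U), π₁ q ∈ Z → π₂ q ∈ Z → q ∈ S)
    (hπ₁ : ∀ q ∈ (U ×ˢ U) ×ˢ (U ×ˢ U), π₁ q ∈ U) (hπ₂ : ∀ q ∈ (U ×ˢ U) ×ˢ (U ×ˢ U), π₂ q ∈ U) :
    (((U ×ˢ U) ×ˢ (U ×ˢ U)).filter fun q => x (π₁ q) = 0 ∧ x (π₂ q) = 0).card ≤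
      Z.card * Z.card * (U.card * U.card) := by
  rw [← hS]
  refine Finset.card_le_card fun q hq => ?_
  rw [Finset.mem_filter] at hq
  exact hmem q hq.1 (hZ _ (hπ₁ q hq.1) hq.2.1) (hZ _ (hπ₂ q hq.1) hq.2.2)

/-- **Index energy versus set energy.** If the fibres of `x` on `U` have at most two points, the
number of index quadruples `q ∈ U⁴` with `x q₁₁ x q₂₂ = x q₁₂ x q₂₁` is at most
`16 E×(x(U) ∖ {0}) + 16 |U|²`. [folklore] -/
theorem index_energy_le (U : Finset ι) (x : ι → F)
    (hfib : ∀ y : F, (U.filter fun u => x u = y).card ≤ 2) :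
    ((((U ×ˢ U) ×ˢ (U ×ˢ U)).filter fun q : (ι × ι) × ι × ι =>
        x q.1.1 * x q.2.2 = x q.1.2 * x q.2.1).card : ℕ) ≤
      16 * Finset.mulEnergy ((U.image x).erase 0) ((U.image x).erase 0) + 16 * (U.card * U.card) := by
  classical
  set A := (U.image x).erase 0 with hA
  set P := (U ×ˢ U) ×ˢ (U ×ˢ U) with hP
  set T := P.filter fun q : (ι × ι) × ι × ι => x q.1.1 * x q.2.2 = x q.1.2 * x q.2.1 with hT
  set Z := U.filter fun u => x u = 0 with hZ
  have hZ2 : Z.card ≤ 2 := hfib 0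
  have hZmem : ∀ u ∈ U, x u = 0 → u ∈ Z := fun u hu h0 => Finset.mem_filter.mpr ⟨hu, h0⟩
  -- the non-degenerate part
  set Tnd := T.filter fun q => x q.1.1 ≠ 0 ∧ x q.1.2 ≠ 0 ∧ x q.2.1 ≠ 0 ∧ x q.2.2 ≠ 0 with hTnd
  set D₁ := P.filter fun q => x q.1.1 = 0 ∧ x q.1.2 = 0 with hD₁
  set D₂ := P.filter fun q => x q.1.1 = 0 ∧ x q.2.1 = 0 with hD₂
  set D₃ := P.filter fun q => x q.1.2 = 0 ∧ x q.2.2 = 0 with hD₃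
  set D₄ := P.filter fun q => x q.2.1 = 0 ∧ x q.2.2 = 0 with hD₄
  have hcover : T ⊆ Tnd ∪ D₁ ∪ D₂ ∪ D₃ ∪ D₄ := by
    intro q hq
    have hqP : q ∈ P := (Finset.mem_filter.mp hq).1
    have heq : x q.1.1 * x q.2.2 = x q.1.2 * x q.2.1 := (Finset.mem_filter.mp hq).2
    simp only [Finset.mem_union, hTnd, hD₁, hD₂, hD₃, hD₄, Finset.mem_filter]
    by_cases h11 : x q.1.1 = 0
    · rw [h11, zero_mul] at heq
      rcases mul_eq_zero.mp heq.symm with h | h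
      · exact Or.inl (Or.inl (Or.inl (Or.inr ⟨hqP, h11, h⟩)))
      · exact Or.inl (Or.inl (Or.inr ⟨hqP, h11, h⟩))
    by_cases h22 : x q.2.2 = 0
    · rw [h22, mul_zero] at heq
      rcases mul_eq_zero.mp heq.symm with h | h
      · exact Or.inl (Or.inr ⟨hqP, h, h22⟩)
      · exact Or.inr ⟨hqP, h, h22⟩
    by_cases h12 : x q.1.2 = 0
    · rw [h12, zero_mul] at heq
      rcases mul_eq_zero.mp heq with h | h
      · exact absurd h h11
      · exact absurd h h22
    by_cases h21 : x q.2.1 = 0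
    · rw [h21, mul_zero] at heq
      rcases mul_eq_zero.mp heq with h | h
      · exact absurd h h11
      · exact absurd h h22
    exact Or.inl (Or.inl (Or.inl (Or.inl ⟨hq, h11, h12, h21, h22⟩)))
  -- degenerate parts: ≤ 4 |U|² each
  have hPmem : ∀ q ∈ P, q.1.1 ∈ U ∧ q.1.2 ∈ U ∧ q.2.1 ∈ U ∧ q.2.2 ∈ U := by
    intro q hq
    simp only [hP, Finset.mem_product] at hq
    exact ⟨hq.1.1, hq.1.2, hq.2.1, hq.2.2⟩
  have hD₁c : D₁.card ≤ Z.card * Z.card * (U.card * U.card) := by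
    exact card_filter_two_zero_le U x Z hZmem (fun q => q.1.1) (fun q => q.1.2)
      ((Z ×ˢ Z) ×ˢ (U ×ˢ U)) (by simp only [Finset.card_product])
      (fun q hq h1 h2 => Finset.mem_product.mpr ⟨Finset.mem_product.mpr ⟨h1, h2⟩,
        Finset.mem_product.mpr ⟨(hPmem q hq).2.2.1, (hPmem q hq).2.2.2⟩⟩)
      (fun q hq => (hPmem q hq).1) (fun q hq => (hPmem q hq).2.1)
  have hD₂c : D₂.card ≤ Z.card * Z.card * (U.card * U.card) := by
    exact card_filter_two_zero_le U x Z hZmem (fun q => q.1.1) (fun q => q.2.1)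
      ((Z ×ˢ U) ×ˢ (Z ×ˢ U)) (by simp only [Finset.card_product]; ring)
      (fun q hq h1 h2 => Finset.mem_product.mpr ⟨Finset.mem_product.mpr ⟨h1, (hPmem q hq).2.1⟩,
        Finset.mem_product.mpr ⟨h2, (hPmem q hq).2.2.2⟩⟩)
      (fun q hq => (hPmem q hq).1) (fun q hq => (hPmem q hq).2.2.1)
  have hD₃c : D₃.card ≤ Z.card * Z.card * (U.card * U.card) := by
    exact card_filter_two_zero_le U x Z hZmem (fun q => q.1.2) (fun q => q.2.2)
      ((U ×ˢ Z) ×ˢ (U ×ˢ Z)) (by simp only [Finset.card_product]; ring)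
      (fun q hq h1 h2 => Finset.mem_product.mpr ⟨Finset.mem_product.mpr ⟨(hPmem q hq).1, h1⟩,
        Finset.mem_product.mpr ⟨(hPmem q hq).2.2.1, h2⟩⟩)
      (fun q hq => (hPmem q hq).2.1) (fun q hq => (hPmem q hq).2.2.2)
  have hD₄c : D₄.card ≤ Z.card * Z.card * (U.card * U.card) := by
    exact card_filter_two_zero_le U x Z hZmem (fun q => q.2.1) (fun q => q.2.2)
      ((U ×ˢ U) ×ˢ (Z ×ˢ Z)) (by simp only [Finset.card_product]; ring)
      (fun q hq h1 h2 => Finset.mem_product.mpr ⟨Finset.mem_product.mpr ⟨(hPmem q hq).1, (hPmem q hq).2.1⟩,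
        Finset.mem_product.mpr ⟨h1, h2⟩⟩)
      (fun q hq => (hPmem q hq).2.2.1) (fun q hq => (hPmem q hq).2.2.2)
  have hZZ : Z.card * Z.card * (U.card * U.card) ≤ 4 * (U.card * U.card) :=
    Nat.mul_le_mul_right _ (by nlinarith)
  -- the non-degenerate part maps ≤ 16-to-1 into the energy quadruples of A
  set Φ : ((ι × ι) × ι × ι) → (F × F) × F × F :=
    fun q => ((x q.1.1, x q.1.2), (x q.2.2, x q.2.1)) with hΦ
  have hA_mem : ∀ u ∈ U, x u ≠ 0 → x u ∈ A := by
    intro u hu h0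
    rw [hA, Finset.mem_erase]
    exact ⟨h0, Finset.mem_image_of_mem _ hu⟩
  have himg : Tnd.image Φ ⊆ ((A ×ˢ A) ×ˢ (A ×ˢ A)).filter
      fun y : (F × F) × F × F => y.1.1 * y.2.1 = y.1.2 * y.2.2 := by
    intro y hy
    rw [Finset.mem_image] at hy
    obtain ⟨q, hq, rfl⟩ := hy
    rw [hTnd, Finset.mem_filter, hT, Finset.mem_filter] at hq
    obtain ⟨⟨hqP, heq⟩, h11, h12, h21, h22⟩ := hq
    obtain ⟨m11, m12, m21, m22⟩ := hPmem q hqP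
    simp only [Finset.mem_filter, Finset.mem_product, hΦ]
    exact ⟨⟨⟨hA_mem _ m11 h11, hA_mem _ m12 h12⟩, hA_mem _ m22 h22, hA_mem _ m21 h21⟩, heq⟩
  have hfib16 : ∀ y ∈ Tnd.image Φ, (Tnd.filter fun q => Φ q = y).card ≤ 16 := by
    intro y _
    have hsub : (Tnd.filter fun q => Φ q = y) ⊆
        ((U.filter fun u => x u = y.1.1) ×ˢ (U.filter fun u => x u = y.1.2)) ×ˢ
          ((U.filter fun u => x u = y.2.2) ×ˢ (U.filter fun u => x u = y.2.1)) := by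
      intro q hq
      rw [Finset.mem_filter, hTnd, Finset.mem_filter, hT, Finset.mem_filter] at hq
      obtain ⟨⟨⟨hqP, _⟩, _⟩, hqy⟩ := hq
      obtain ⟨m11, m12, m21, m22⟩ := hPmem q hqP
      have e11 : x q.1.1 = y.1.1 := congrArg (fun v => v.1.1) hqy
      have e12 : x q.1.2 = y.1.2 := congrArg (fun v => v.1.2) hqy
      have e22 : x q.2.2 = y.2.1 := congrArg (fun v => v.2.1) hqy
      have e21 : x q.2.1 = y.2.2 := congrArg (fun v => v.2.2) hqy
      simp only [Finset.mem_product, Finset.mem_filter]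
      exact ⟨⟨⟨m11, e11⟩, m12, e12⟩, ⟨m21, e21⟩, m22, e22⟩
    refine (Finset.card_le_card hsub).trans ?_
    rw [Finset.card_product, Finset.card_product, Finset.card_product]
    have a := hfib y.1.1; have b := hfib y.1.2; have c := hfib y.2.2; have d := hfib y.2.1
    calc _ ≤ (2 * 2) * (2 * 2) :=
          Nat.mul_le_mul (Nat.mul_le_mul a b) (Nat.mul_le_mul c d)
      _ = 16 := by norm_num
  have hTnd_le : Tnd.card ≤ 16 * Finset.mulEnergy A A := by
    refine (Finset.card_le_mul_card_image Tnd 16 hfib16).trans (Nat.mul_le_mul_left _ ?_)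
    unfold Finset.mulEnergy
    exact Finset.card_le_card himg
  -- assemble
  calc T.card ≤ (Tnd ∪ D₁ ∪ D₂ ∪ D₃ ∪ D₄).card := Finset.card_le_card hcover
    _ ≤ Tnd.card + D₁.card + D₂.card + D₃.card + D₄.card := by
        refine (Finset.card_union_le _ _).trans ?_
        refine Nat.add_le_add_right ((Finset.card_union_le _ _).trans ?_) _
        refine Nat.add_le_add_right ((Finset.card_union_le _ _).trans ?_) _
        exact Nat.add_le_add_right (Finset.card_union_le _ _) _
    _ ≤ 16 * Finset.mulEnergy A A + 16 * (U.card * U.card) := by omega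

end Literature.Combinatorics.Additive
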